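import Summits.Ventures.CertifiedQuantumChemistry.Rows.OneHoleSectorsExact
import Summits.Ventures.CertifiedQuantumChemistry.Rows.HubbardRingTVWeakCoupling
import HarnessLib

/-!
# Ventures/CertifiedQuantumChemistry — Rows/HubbardRingTVPolarizedSectorsExact.lean: the SPIN-POLARISED
# sectors `(a, 0)`, `(0, b)` and the ONE-BAND-FULL sectors `(a, L)`, `(L, b)` of every TV-H ring are solved
# EXACTLY by the level-DQG programme, for every `t` and every `U` — the certified gap of the ring lives in
# `1 ≤ a, b ≤ L − 1`

HONEST FRAMING (verbatim): certified bounds for a stated model Hamiltonian in a stated basis; not a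
claim about the real molecule beyond that model.

Seat rdm-B, ROWS courtesy file (theorems only; no `def`, no notation, no instance; zero compute). The
on-site repulsion of `hubbardRingTV L t U` acts between OPPOSITE spins only, so a sector without minority
electrons is a free-fermion problem; the point typed here is that the level-DQG programme KNOWS this: on
every `(a, 0)`-sector-feasible pair the doublon weights vanish (gen 38's `G`-diagonal ceiling
`Σ_p Re d_p ≤ min(a, b) = 0`), so the programme's value, like the exact energy, does not depend on `U`
(gen 38's two `U`-Lipschitz statements with constant `min(a, b) = 0`), and at `U = 0` the sector programme
is exact (gen 38's `hubbardRingTV_pqgSectorEnergy_zero_repulsion`, the bathtub theorem). Particle–hole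
duality (gen 38) carries this to the sectors with one spin band FULL. Together with
`Rows/OneHoleSectorsExact.lean` (outer fillings) the relaxation gap of a ring can only live in the sectors
`1 ≤ a, b ≤ L − 1` with `3 ≤ a + b ≤ 2L − 3`; on the triangle `L = 3` that leaves `(1, 2)` and `(2, 1)`.

* §1 `WeakCoupling.doublon_eq_zero_of_polarized` (on an `(a, 0)`- or `(0, b)`-sector-feasible pair of ANY
  orbital set every `d_p = 0`), `…sum_doublon_re_eq_zero_of_polarized`.
* §2 `hubbardRingTV_energy_polarized_indep` / `hubbardRingTV_pqgSectorEnergy_polarized_indep`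
  (`E₀(L; t, U; a, 0) = E₀(L; t, U′; a, 0)`, `OPT_DQG` likewise, and the `(0, b)` twins: every `t, U, U′`),
  **`hubbardRingTV_pqgSectorEnergy_eq_energy_polarized`** (`OPT_DQG(L; t, U; a, 0) = E₀(L; t, U; a, 0)
  = E₀(L; t, 0; a, 0)` and the `(0, b)` twin — EXACT, every `t, U`, `a, b ≤ L`).
* §3 **`hubbardRingTV_pqgSectorEnergy_eq_energy_bandFull`** (`(a, L)` and `(L, b)`: exact, every `t, U`),
  `hubbardRingTV_energy_bandFull` (`E₀(L; t, U; a, L) = E₀(L; −t, 0; L − a, 0) + U·a` — free holes plus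
  `U` per minority electron; same for `(L, b)`).
* §4 **`hubbardRingTV_pqgSectorEnergy_eq_energy_of_boundary`** (`a = 0 ∨ b = 0 ∨ a = L ∨ b = L` ⇒ exact),
  `hubbardRingTV_gap_eq_zero_of_boundary`, the `T`-rung twin by squeeze,
  **`hubbardRingTV_pqgSectorEnergy_eq_energy_unless_interior`** (exact unless `1 ≤ a, b ≤ L − 1` and
  `3 ≤ a + b ≤ 2L − 3`), **`hubbardRingTV_three_exact_unless`** (the triangle: exact in every sector other
  than `(1, 2)`, `(2, 1)`).

READING: statements about VALUES of the abstract programme and the exact sector energies of the cell's own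
model object; nothing here is a certificate, a row or a value of record; nothing is claimed about the
interior sectors, in particular nothing about S-U's `(n, n)`, `n ≥ 2`. All PROVED (0 sorry, standard
axioms); no defs, no named facts. References (docstring-only): E. H. Lieb, PRL 62 (1989) 1201 (sectors);
D. A. Mazziotti, Adv. Chem. Phys. 134 (2007) ch. 3 §II.B eq. (15) (the `G`-condition), §II.F. Tree (REUSED):
`WeakCoupling.sum_doublon_re_le_min` / `…_nonneg`, `hubbardRingTV_energy_le_add_mul_groundDoublon`,
`hubbardRingTV_pqgSectorEnergy_le_add_mul_min`, `StrongCouplingDoublon.hubbardRingTV_pqgSectorEnergy_mono`,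
`hubbardRingTV_pqgSectorEnergy_zero_repulsion` (gen 38, `Rows/HubbardRingTVWeakCoupling`);
`hubbardRingTV_energy_particleHole`, `hubbardRingTV_pqgSectorEnergy_particleHole` (gen 38);
`hubbardRingTV_pqgSectorEnergy_eq_energy_of_outer`, `OneHole.pqgT1T2pSectorEnergy_eq_sectorGroundEnergy_of_pqg`
(this gen, `Rows/OneHoleSectorsExact`); `hubbardRingTV_hamiltonian_isHermitian`.
-/

noncomputable section

namespace Summit.Ventures.CertifiedQuantumChemistry

open Matrix Finset Literature.MathematicalPhysics.QuantumLattice Literature.MathematicalPhysics.QuantumChemistry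
open Summit.Ventures.CertifiedQuantumChemistry.Hamiltonians
open scoped ComplexOrder

/-! ## §1 On a spin-polarised sector-feasible pair every doublon weight vanishes -/

namespace WeakCoupling

section Abstract

variable {Λ : Type*} [LinearOrder Λ] [Fintype Λ]
variable {γ : Matrix (Orb Λ) (Orb Λ) ℂ} {Γ : Matrix (Orb Λ × Orb Λ) (Orb Λ × Orb Λ) ℂ}

/-- **`Σ_p Re d_p = 0` on every `(a, b)`-sector-feasible pair with `a = 0` or `b = 0`** (the window
`0 ≤ Σ_p Re d_p ≤ min(a, b)` of gen 38 collapses). [folklore] -/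
theorem sum_doublon_re_eq_zero_of_polarized {a b : ℕ} (hf : IsDQGFeasibleSector a b γ Γ) (hab : a = 0 ∨ b = 0) :
    ∑ p : Λ, (Γ (orb p 0, orb p 1) (orb p 0, orb p 1)).re = 0 := by
  have h1 := sum_doublon_re_le_min hf
  have h2 := sum_doublon_re_nonneg hf
  have h0 : min (a : ℝ) (b : ℝ) = 0 := by
    rcases hab with rfl | rfl
    · rw [Nat.cast_zero]; exact min_eq_left (Nat.cast_nonneg b)
    · rw [Nat.cast_zero]; exact min_eq_right (Nat.cast_nonneg a)
  rw [h0] at h1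
  exact le_antisymm h1 h2

/-- **Every doublon weight vanishes on a spin-polarised sector-feasible pair**: `Γ_{(p↑,p↓),(p↑,p↓)} = 0`
for all `p` when `a = 0` or `b = 0` (non-negative reals summing to zero; diagonal entries of `Γ ⪰ 0` are
real). [folklore] -/
theorem doublon_eq_zero_of_polarized {a b : ℕ} (hf : IsDQGFeasibleSector a b γ Γ) (hab : a = 0 ∨ b = 0)
    (p : Λ) : Γ (orb p 0, orb p 1) (orb p 0, orb p 1) = 0 := by
  have hnn : ∀ q ∈ (Finset.univ : Finset Λ), 0 ≤ (Γ (orb q 0, orb q 1) (orb q 0, orb q 1)).re := fun q _ =>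
    (Complex.nonneg_iff.1 (hf.dqg.d_psd.diag_nonneg (i := (orb q 0, orb q 1)))).1
  have hre := (Finset.sum_eq_zero_iff_of_nonneg hnn).1 (sum_doublon_re_eq_zero_of_polarized hf hab) p
    (Finset.mem_univ p)
  have him := (Complex.nonneg_iff.1 (hf.dqg.d_psd.diag_nonneg (i := (orb p 0, orb p 1)))).2
  exact Complex.ext hre him.symm

end Abstract

end WeakCoupling

/-! ## §2 The spin-polarised sectors `(a, 0)`, `(0, b)` of the ring: values `U`-independent, programme exact -/

section Polarized

variable {L : ℕ}

/-- **`E₀(L; t, U; a, b)` DOES NOT DEPEND ON `U` WHEN `a = 0` OR `b = 0`** (`a, b ≤ L`, every `t`): gen 38's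
two-sided estimate `E₀(U′) ≤ E₀(U) + (U′ − U)·s` with `0 ≤ s ≤ min(a, b) = 0`, in both directions. [folklore] -/
theorem hubbardRingTV_energy_polarized_indep (t U U' : ℚ) {a b : ℕ} (ha : a ≤ L) (hb : b ≤ L)
    (hab : a = 0 ∨ b = 0) :
    Model.energy (hubbardRingTV L t U) a b = Model.energy (hubbardRingTV L t U') a b := by
  have h0 : min (a : ℝ) (b : ℝ) = 0 := by
    rcases hab with rfl | rfl
    · rw [Nat.cast_zero]; exact min_eq_left (Nat.cast_nonneg b)
    · rw [Nat.cast_zero]; exact min_eq_right (Nat.cast_nonneg a)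
  obtain ⟨s, hs0, hs1, h1⟩ := hubbardRingTV_energy_le_add_mul_groundDoublon (L := L) t U U' ha hb
  obtain ⟨s', hs0', hs1', h2⟩ := hubbardRingTV_energy_le_add_mul_groundDoublon (L := L) t U' U ha hb
  rw [h0] at hs1 hs1'
  have hs : s = 0 := le_antisymm hs1 hs0
  have hs' : s' = 0 := le_antisymm hs1' hs0'
  rw [hs, mul_zero, add_zero] at h1
  rw [hs', mul_zero, add_zero] at h2
  exact le_antisymm h2 h1

/-- **`OPT_DQG(L; t, U; a, b)` DOES NOT DEPEND ON `U` WHEN `a = 0` OR `b = 0`** (`a, b ≤ L`, every `t`): the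
value is non-decreasing in `U` and grows at most with slope `min(a, b) = 0` (gen 36 / gen 38). [folklore] -/
theorem hubbardRingTV_pqgSectorEnergy_polarized_indep (t U U' : ℚ) {a b : ℕ} (ha : a ≤ L) (hb : b ≤ L)
    (hab : a = 0 ∨ b = 0) :
    Model.pqgSectorEnergy (hubbardRingTV L t U) a b = Model.pqgSectorEnergy (hubbardRingTV L t U') a b := by
  have h0 : min (a : ℝ) (b : ℝ) = 0 := by
    rcases hab with rfl | rfl
    · rw [Nat.cast_zero]; exact min_eq_left (Nat.cast_nonneg b)
    · rw [Nat.cast_zero]; exact min_eq_right (Nat.cast_nonneg a)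
  wlog hUU' : U ≤ U' generalizing U U'
  · exact (this U' U (not_le.1 hUU').le).symm
  have h1 : Model.pqgSectorEnergy (hubbardRingTV L t U) a b ≤ Model.pqgSectorEnergy (hubbardRingTV L t U') a b :=
    StrongCouplingDoublon.hubbardRingTV_pqgSectorEnergy_mono t hUU' ha hb
  have h2 := hubbardRingTV_pqgSectorEnergy_le_add_mul_min (L := L) t hUU' ha hb
  rw [h0, mul_zero, add_zero] at h2
  exact le_antisymm h1 h2

/-- **THE SPIN-POLARISED SECTORS ARE SOLVED EXACTLY BY LEVEL DQG**: for every `t, U` and `a, b ≤ L` with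
`a = 0` or `b = 0`, `OPT_DQG(L; t, U; a, b) = E₀(L; t, U; a, b)` — both equal their common `U = 0` value, where
the sector programme of the one-body ring is exact (bathtub). [folklore] -/
theorem hubbardRingTV_pqgSectorEnergy_eq_energy_polarized (t U : ℚ) {a b : ℕ} (ha : a ≤ L) (hb : b ≤ L)
    (hab : a = 0 ∨ b = 0) :
    Model.pqgSectorEnergy (hubbardRingTV L t U) a b = Model.energy (hubbardRingTV L t U) a b := by
  rw [hubbardRingTV_pqgSectorEnergy_polarized_indep t U 0 ha hb hab, hubbardRingTV_energy_polarized_indep t U 0 ha hb hab]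
  exact hubbardRingTV_pqgSectorEnergy_zero_repulsion L t ha hb

/-- The values in the polarised sectors are the FREE-FERMION ones: `E₀(L; t, U; a, 0) = E₀(L; t, 0; a, 0)` and
`E₀(L; t, U; 0, b) = E₀(L; t, 0; 0, b)` for every `U` (`a, b ≤ L`). [folklore] -/
theorem hubbardRingTV_energy_polarized_eq_free (t U : ℚ) {a b : ℕ} (ha : a ≤ L) (hb : b ≤ L) :
    Model.energy (hubbardRingTV L t U) a 0 = Model.energy (hubbardRingTV L t 0) a 0 ∧
      Model.energy (hubbardRingTV L t U) 0 b = Model.energy (hubbardRingTV L t 0) 0 b :=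
  ⟨hubbardRingTV_energy_polarized_indep t U 0 ha (Nat.zero_le _) (Or.inr rfl),
    hubbardRingTV_energy_polarized_indep t U 0 (Nat.zero_le _) hb (Or.inl rfl)⟩

end Polarized

/-! ## §3 The one-band-full sectors `(a, L)`, `(L, b)`: exact by particle–hole duality -/

section BandFull

variable {L : ℕ}

/-- **THE ONE-BAND-FULL SECTORS ARE SOLVED EXACTLY BY LEVEL DQG**: for every `t, U` and `a, b ≤ L` with
`a = L` or `b = L`, `OPT_DQG(L; t, U; a, b) = E₀(L; t, U; a, b)` — the particle–hole images (gen 38) of the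
spin-polarised sectors of `hubbardRingTV L (−t) U`, with the same shift `U·(a + b − L)` on both sides. [folklore] -/
theorem hubbardRingTV_pqgSectorEnergy_eq_energy_bandFull (t U : ℚ) {a b : ℕ} (ha : a ≤ L) (hb : b ≤ L)
    (hab : a = L ∨ b = L) :
    Model.pqgSectorEnergy (hubbardRingTV L t U) a b = Model.energy (hubbardRingTV L t U) a b := by
  have hLa : L - a ≤ L := Nat.sub_le _ _
  have hLb : L - b ≤ L := Nat.sub_le _ _
  have hpol : L - a = 0 ∨ L - b = 0 := by
    rcases hab with rfl | rfl
    · exact Or.inl (Nat.sub_self _)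
    · exact Or.inr (Nat.sub_self _)
  have e := hubbardRingTV_energy_particleHole (L := L) (-t) U hLa hLb
  have p := hubbardRingTV_pqgSectorEnergy_particleHole (L := L) (-t) U hLa hLb
  rw [neg_neg, Nat.sub_sub_self ha, Nat.sub_sub_self hb] at e p
  rw [e, p, hubbardRingTV_pqgSectorEnergy_eq_energy_polarized (-t) U hLa hLb hpol]

/-- The values in the one-band-full sectors: `E₀(L; t, U; a, L) = E₀(L; −t, 0; L − a, 0) + U·a` (free holes
at hopping `−t`, plus `U` for each of the `a` minority electrons, all of which sit on doubly occupied sites)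
and `E₀(L; t, U; L, b) = E₀(L; −t, 0; 0, L − b) + U·b` (`a, b ≤ L`). [folklore] -/
theorem hubbardRingTV_energy_bandFull (t U : ℚ) {a b : ℕ} (ha : a ≤ L) (hb : b ≤ L) :
    Model.energy (hubbardRingTV L t U) a L = Model.energy (hubbardRingTV L (-t) 0) (L - a) 0 + (U : ℝ) * a ∧
      Model.energy (hubbardRingTV L t U) L b = Model.energy (hubbardRingTV L (-t) 0) 0 (L - b) + (U : ℝ) * b := by
  have hLa : L - a ≤ L := Nat.sub_le _ _
  have hLb : L - b ≤ L := Nat.sub_le _ _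
  have e1 := hubbardRingTV_energy_particleHole (L := L) (-t) U hLa (Nat.zero_le L)
  have e2 := hubbardRingTV_energy_particleHole (L := L) (-t) U (Nat.zero_le L) hLb
  rw [neg_neg, Nat.sub_sub_self ha, Nat.sub_zero] at e1
  rw [neg_neg, Nat.sub_sub_self hb, Nat.sub_zero] at e2
  refine ⟨?_, ?_⟩
  · rw [e1, (hubbardRingTV_energy_polarized_eq_free (-t) U hLa (Nat.zero_le L)).1, Nat.cast_sub ha, Nat.cast_zero]
    ring
  · rw [e2, (hubbardRingTV_energy_polarized_eq_free (-t) U (Nat.zero_le L) hLb).2, Nat.cast_sub hb, Nat.cast_zero]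
    ring

end BandFull

/-! ## §4 Packaging: the certified gap of a ring lives in the interior sectors -/

section Boundary

variable (L : ℕ) (t U : ℚ)

/-- **LEVEL DQG IS EXACT ON THE BOUNDARY OF THE SECTOR SQUARE**: for every `t, U` and `a, b ≤ L` with
`a = 0 ∨ b = 0 ∨ a = L ∨ b = L`, `OPT_DQG(L; t, U; a, b) = E₀(L; t, U; a, b)`. [folklore] -/
theorem hubbardRingTV_pqgSectorEnergy_eq_energy_of_boundary {a b : ℕ} (ha : a ≤ L) (hb : b ≤ L)
    (h : a = 0 ∨ b = 0 ∨ a = L ∨ b = L) :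
    Model.pqgSectorEnergy (hubbardRingTV L t U) a b = Model.energy (hubbardRingTV L t U) a b := by
  rcases h with h | h | h | h
  · exact hubbardRingTV_pqgSectorEnergy_eq_energy_polarized t U ha hb (Or.inl h)
  · exact hubbardRingTV_pqgSectorEnergy_eq_energy_polarized t U ha hb (Or.inr h)
  · exact hubbardRingTV_pqgSectorEnergy_eq_energy_bandFull t U ha hb (Or.inl h)
  · exact hubbardRingTV_pqgSectorEnergy_eq_energy_bandFull t U ha hb (Or.inr h)

/-- … so the certified gap `E₀ − OPT_DQG` vanishes on the boundary of the sector square. [folklore] -/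
theorem hubbardRingTV_gap_eq_zero_of_boundary {a b : ℕ} (ha : a ≤ L) (hb : b ≤ L)
    (h : a = 0 ∨ b = 0 ∨ a = L ∨ b = L) :
    Model.energy (hubbardRingTV L t U) a b - Model.pqgSectorEnergy (hubbardRingTV L t U) a b = 0 := by
  rw [hubbardRingTV_pqgSectorEnergy_eq_energy_of_boundary L t U ha hb h, sub_self]

/-- … and so does the `T`-rung's gap (squeeze): `OPT_DQGT1T2′(L; t, U; a, b) = E₀(L; t, U; a, b)` on the
boundary of the sector square (the Literature value function on the ring's cast tables). [folklore] -/
theorem hubbardRingTV_pqgT1T2pSectorEnergy_eq_energy_of_boundary {a b : ℕ} (ha : a ≤ L) (hb : b ≤ L)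
    (h : a = 0 ∨ b = 0 ∨ a = L ∨ b = L) :
    pqgT1T2pSectorEnergy (fun p q => (((hubbardRingTV L t U).h p q : ℚ) : ℂ))
        (fun p q r s => (((hubbardRingTV L t U).eri p q r s : ℚ) : ℂ))
        (((hubbardRingTV L t U).ecore : ℚ) : ℂ) a b = Model.energy (hubbardRingTV L t U) a b :=
  OneHole.pqgT1T2pSectorEnergy_eq_sectorGroundEnergy_of_pqg (hubbardRingTV_hamiltonian_isHermitian L t U)
    (by rw [Fintype.card_fin]; exact ha) (by rw [Fintype.card_fin]; exact hb)
    (hubbardRingTV_pqgSectorEnergy_eq_energy_of_boundary L t U ha hb h)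

/-- **THE CERTIFIED GAP OF A RING LIVES IN THE INTERIOR**: for every `t, U` and `a, b ≤ L`, level DQG is
exact UNLESS `1 ≤ a ≤ L − 1`, `1 ≤ b ≤ L − 1` and `3 ≤ a + b ≤ 2L − 3` (boundary of the sector square, or an
outer filling `N ≤ 2` / `N ≥ 2L − 2`). [folklore] -/
theorem hubbardRingTV_pqgSectorEnergy_eq_energy_unless_interior {a b : ℕ} (ha : a ≤ L) (hb : b ≤ L)
    (h : ¬ (1 ≤ a ∧ a + 1 ≤ L ∧ 1 ≤ b ∧ b + 1 ≤ L ∧ 3 ≤ a + b ∧ a + b + 3 ≤ 2 * L)) :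
    Model.pqgSectorEnergy (hubbardRingTV L t U) a b = Model.energy (hubbardRingTV L t U) a b := by
  by_cases hbd : a = 0 ∨ b = 0 ∨ a = L ∨ b = L
  · exact hubbardRingTV_pqgSectorEnergy_eq_energy_of_boundary L t U ha hb hbd
  · exact hubbardRingTV_pqgSectorEnergy_eq_energy_of_outer L t U ha hb (by omega)

/-- **THE TRIANGLE `L = 3`**: for every `t, U`, level DQG is exact in every sector `a, b ≤ 3` other than
`(1, 2)` and `(2, 1)` (the only interior sectors of the 3-ring). [folklore] -/
theorem hubbardRingTV_three_exact_unless (t U : ℚ) {a b : ℕ} (ha : a ≤ 3) (hb : b ≤ 3)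
    (h : (a, b) ≠ (1, 2) ∧ (a, b) ≠ (2, 1)) :
    Model.pqgSectorEnergy (hubbardRingTV 3 t U) a b = Model.energy (hubbardRingTV 3 t U) a b := by
  refine hubbardRingTV_pqgSectorEnergy_eq_energy_unless_interior 3 t U ha hb fun hint => ?_
  obtain ⟨h1, h2⟩ := h
  have : (a = 1 ∧ b = 2) ∨ (a = 2 ∧ b = 1) := by omega
  rcases this with ⟨rfl, rfl⟩ | ⟨rfl, rfl⟩
  · exact h1 rfl
  · exact h2 rfl

end Boundary

end Summit.Ventures.CertifiedQuantumChemistry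

end
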